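import Literature.NumberTheory.EllipticCurves.ZpExtensionEisensteinOrdinaryFilSaturationProofs
import Literature.NumberTheory.EllipticCurves.LocalKernelOfReductionDivisibleThreeProofs
import Literature.NumberTheory.EllipticCurves.TorsionFilAtCountMultiplicativeThreeProofs
import HarnessLib

/-!
# (ONTO), (SAT) and the transfer of the twisted plus parts at a place `v ∣ 3` of MULTIPLICATIVE reduction (theorems only)

Topic `NumberTheory/EllipticCurves` (LEAD `bsd-wall-utd-p1`, crux r205 stmt-BirchSwinnertonDyer-24737 `TwinAlgMuZeroAtThree`,
line `beta-road`, stub `stub_howardOutputsOfFamily`, E2 unit at `v ∣ 3`; no definition, no named fact, no instance, no `sorry`).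
Cell x9's three curve-level wrappers for the ordinary datum `ordinaryFiltrationAt` at a place `v ∋ p` —
`eisensteinTwistTransfer_mem_twistedFil_ordinaryFiltrationAt` (`ZpExtensionEisensteinOrdinaryFilTransferProofs`: the two-index
family preserves `A ⊗ Fil_v`), `exists_mem_twistedFil_transfer_eq_ordinaryFiltrationAt` ((ONTO)) and
`mem_twistedFil_of_transfer_mem_ordinaryFiltrationAt` ((SAT)) (`ZpExtensionEisensteinOrdinaryFilSaturationProofs`) — assume GOOD
reduction with an ordinary point, used only through `exists_mem_torsionFilAt_reduce_eq` (`hFsurj`) and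
`exists_addEquiv_mem_torsionFilAt_iff` (adapted basis).  At `p = 3` both are available at places of MULTIPLICATIVE reduction
(`LocalKernelOfReductionDivisibleThreeProofs`, `TorsionFilAtCountMultiplicativeThreeProofs`); this file restates the three wrappers
there (same generic cores `ZpExtension.eisensteinTwistTransfer_mem_twistedFil`,
`ZpExtension.OrdinaryFiltration.exists_mem_twistedFil_transfer_eq` / `.mem_twistedFil_of_transfer_mem`).  They are the
`hgood`-inputs of x9's (ANN-SAT) files `ZpExtensionEisensteinDVRSettingH4AnnSat{,Flip,OfLifts}Proofs`, whose twin versions at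
multiplicative `v ∣ 3` follow by the same substitution.  BSD is not proved by any of this.

References: [Howard2004HeegnerKolyvagin] Def. 1.1.3, H.0, §3.1 (arXiv p. 7 L57, p. 15 L56–62); [GreenbergLNM1716] §2 p. 82.
-/

set_option autoImplicit false

noncomputable section

open scoped TensorProduct ContRepresentation NumberField
open Function Field

namespace WeierstrassCurve

open Literature.NumberTheory.EllipticCurves Literature.NumberTheory.GaloisRepresentations
open Literature.NumberTheory.EllipticCurves.IwasawaAlgebra IsDedekindDomain

variable {K : Type} [Field K] [NumberField K] (W : WeierstrassCurve K) [W.IsElliptic]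
  (v : HeightOneSpectrum (𝓞 K)) (κ : ZpExtension K 3) {m : ℕ} (hm : 1 ≤ m)
  (t : ∀ k, (W.torsionGaloisModule (((3 : ℕ) : ℤ) ^ (k + 1))).toContRepresentation →ⁱL
    (W.torsionGaloisModule (((3 : ℕ) : ℤ) ^ k)).toContRepresentation)
  (ht : ∀ k (P : geomTorsion W (((3 : ℕ) : ℤ) ^ (k + 1))), t k P = W.geomTorsionReduce 3 k P)

/-- **The two-index family of the curve's Eisenstein tower preserves the twisted plus parts `A_{m,k} ⊗ Fil_v E[3^k]`** at a place
`v ∋ 3` of MULTIPLICATIVE reduction (x9's `eisensteinTwistTransfer_mem_twistedFil_ordinaryFiltrationAt`, multiplicative places: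
`E₁(K̄_v)` is `3`-divisible there). [cite: Howard2004HeegnerKolyvagin, Def. 1.1.3 and §3.1 (arXiv p. 15, L56–62)] [cite: GreenbergLNM1716, §2 p. 82] -/
theorem eisensteinTwistTransfer_mem_twistedFil_ordinaryFiltrationAt_of_hasMultiplicativeReductionAt_three
    (h3v : ((3 : ℕ) : 𝓞 K) ∈ v.asIdeal) (hmult : W.HasMultiplicativeReductionAt v)
    (a b : ℕ) (x : EisensteinCoeff.Twisted 3 m a (geomTorsion W (((3 : ℕ) : ℤ) ^ a)))
    (hx : x ∈ (W.ordinaryFiltrationAt v t ht).twistedFil (p := 3) (m := m) a) :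
    κ.eisensteinTwistTransfer (fun k ↦ W.torsionGaloisModule (((3 : ℕ) : ℤ) ^ k)) t hm
        (W.torsionGaloisModule_transition_hypotheses t (fun k P ↦ by rw [ht]; rfl)).1
        (W.torsionGaloisModule_transition_hypotheses t (fun k P ↦ by rw [ht]; rfl)).2.1
        (W.torsionGaloisModule_transition_hypotheses t (fun k P ↦ by rw [ht]; rfl)).2.2
        a b x ∈
      (W.ordinaryFiltrationAt v t ht).twistedFil (p := 3) (m := m) b :=
  κ.eisensteinTwistTransfer_mem_twistedFil _ _ hm _ _ _ _
    (fun k y hy ↦ W.exists_mem_torsionFilAt_reduce_eq_of_hasMultiplicativeReductionAt_three v h3v hmult t ht k y hy) a b x hx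

set_option maxHeartbeats 800000 in
/-- **(ONTO) for the curve's Eisenstein tower at a place `v ∋ 3` of MULTIPLICATIVE reduction** — the binder `honto` of
`ZpExtension.propagate_eisensteinSelmerStructure_one_eq_strictSubgroup` for `ordinaryFiltrationAt` (x9's
`exists_mem_twistedFil_transfer_eq_ordinaryFiltrationAt`, multiplicative places).
[cite: Howard2004HeegnerKolyvagin, §3.1 (arXiv p. 15, L56–62)] [cite: GreenbergLNM1716, §2 p. 82] -/
theorem exists_mem_twistedFil_transfer_eq_ordinaryFiltrationAt_of_hasMultiplicativeReductionAt_three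
    (h3v : ((3 : ℕ) : 𝓞 K) ∈ v.asIdeal) (hmult : W.HasMultiplicativeReductionAt v) (ℓ n : ℕ)
    (x' : EisensteinCoeff.Twisted 3 m n (geomTorsion W (((3 : ℕ) : ℤ) ^ n)))
    (hx' : x' ∈ (W.ordinaryFiltrationAt v t ht).twistedFil (p := 3) (m := m) n) :
    ∃ x ∈ (W.ordinaryFiltrationAt v t ht).twistedFil (p := 3) (m := m) (ℓ + n),
      κ.eisensteinTwistTransfer (fun k ↦ W.torsionGaloisModule (((3 : ℕ) : ℤ) ^ k)) t hm
        (W.torsionGaloisModule_transition_hypotheses t (fun k P ↦ by rw [ht]; rfl)).1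
        (W.torsionGaloisModule_transition_hypotheses t (fun k P ↦ by rw [ht]; rfl)).2.1
        (W.torsionGaloisModule_transition_hypotheses t (fun k P ↦ by rw [ht]; rfl)).2.2 (ℓ + n) n x = x' :=
  ZpExtension.OrdinaryFiltration.exists_mem_twistedFil_transfer_eq κ (fun k ↦ W.torsionGaloisModule (((3 : ℕ) : ℤ) ^ k)) t hm
    (W.torsionGaloisModule_transition_hypotheses t (fun k P ↦ by rw [ht]; rfl)).1
    (W.torsionGaloisModule_transition_hypotheses t (fun k P ↦ by rw [ht]; rfl)).2.1
    (W.torsionGaloisModule_transition_hypotheses t (fun k P ↦ by rw [ht]; rfl)).2.2 (W.ordinaryFiltrationAt v t ht)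
    (fun k y hy ↦ W.exists_mem_torsionFilAt_reduce_eq_of_hasMultiplicativeReductionAt_three v h3v hmult t ht k y hy)
    ℓ n x' hx'

set_option maxHeartbeats 800000 in
/-- **(SAT) for the curve's Eisenstein tower at a place `v ∋ 3` of MULTIPLICATIVE reduction** — the binder `hsat` of
`ZpExtension.propagate_eisensteinSelmerStructure_one_eq_strictSubgroup` for `ordinaryFiltrationAt` (`Fil_v E[3^j]` is a rank-one
direct summand: `TorsionFilAtCountMultiplicativeThreeProofs`; x9's `mem_twistedFil_of_transfer_mem_ordinaryFiltrationAt`,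
multiplicative places). [cite: Howard2004HeegnerKolyvagin, H.0 and §3.1 (arXiv p. 7 L57, p. 15 L56–62)] [cite: GreenbergLNM1716, §2] -/
theorem mem_twistedFil_of_transfer_mem_ordinaryFiltrationAt_of_hasMultiplicativeReductionAt_three
    (h3v : ((3 : ℕ) : 𝓞 K) ∈ v.asIdeal) (hmult : W.HasMultiplicativeReductionAt v) (ℓ n : ℕ)
    (x : EisensteinCoeff.Twisted 3 m ℓ (geomTorsion W (((3 : ℕ) : ℤ) ^ ℓ)))
    (hx : κ.eisensteinTwistTransfer (fun k ↦ W.torsionGaloisModule (((3 : ℕ) : ℤ) ^ k)) t hm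
        (W.torsionGaloisModule_transition_hypotheses t (fun k P ↦ by rw [ht]; rfl)).1
        (W.torsionGaloisModule_transition_hypotheses t (fun k P ↦ by rw [ht]; rfl)).2.1
        (W.torsionGaloisModule_transition_hypotheses t (fun k P ↦ by rw [ht]; rfl)).2.2 ℓ (ℓ + n) x ∈
      (W.ordinaryFiltrationAt v t ht).twistedFil (p := 3) (m := m) (ℓ + n)) :
    x ∈ (W.ordinaryFiltrationAt v t ht).twistedFil (p := 3) (m := m) ℓ :=
  ZpExtension.OrdinaryFiltration.mem_twistedFil_of_transfer_mem κ (fun k ↦ W.torsionGaloisModule (((3 : ℕ) : ℤ) ^ k)) t hm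
    (W.torsionGaloisModule_transition_hypotheses t (fun k P ↦ by rw [ht]; rfl)).1
    (W.torsionGaloisModule_transition_hypotheses t (fun k P ↦ by rw [ht]; rfl)).2.1
    (W.torsionGaloisModule_transition_hypotheses t (fun k P ↦ by rw [ht]; rfl)).2.2 (W.ordinaryFiltrationAt v t ht) ℓ n
    (fun h ↦ W.exists_addEquiv_mem_torsionFilAt_iff_of_hasMultiplicativeReductionAt_three v h3v hmult h) x hx

end WeierstrassCurve

end
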